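import Summits.BirchSwinnertonDyer.BirchSwinnertonDyer.Theorems.CMKolyvaginAtInertTwoCMKolyvaginConjectureAtInertTwoPositiveDepthGenusCharacter
import Summits.BirchSwinnertonDyer.BirchSwinnertonDyer.Theorems.CMKolyvaginAtInertTwoCMKolyvaginConjectureAtInertTwoShallowTwistCoordinates
import HarnessLib

/-!
# Crux `CMKolyvaginConjectureAtInertTwo` (stmt-BirchSwinnertonDyer-24648), open stub `stub_positiveDepth`:
# DESCENT OF THE GENUS-CHARACTER FORM TO `K` — `P(ℓ) ∈ 2E(K[ℓ]) ⟺ y_χ ∈ 4·E(K[ℓ])^χ`, and for `χ = χ_θ`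
# (`θ² = ℓ*`) the quarter of `y_χ` is `O` or a point whose TWIST COORDINATES lie in `ι(K)`

Route `CMKolyvaginAtInertTwo` (cell `pub/bsd-eis`, seat `leafhand-bsd-cmkolyvaginatinert-4` g0); helper (`--supports
stmt-BirchSwinnertonDyer-24648 --as helper`). THEOREMS ONLY (no definition, no named fact, no `sorry`); closes nothing;
BSD is proved for no curve. Sequel of `…PositiveDepthGenusCharacter.lean` (p796272, hand -1) and
`…ShallowTwistCoordinates.lean` (p822343/p822377/p822462, hand -3).

WHAT. p796272 proved, at a CM-inert Zhang–Kolyvagin prime `ℓ` on an H₂ frame, `P(ℓ) ∈ 2E(K[ℓ]) ⟺ y_χ ∈ 4E(K[ℓ])` for the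
point `y_χ = Σ_{g ∈ 𝒢_ℓ} χ(g)·g y(ℓ)` attached to ANY `±1`-valued function `χ` odd on `σ_ℓ`; hand -3 wrote the witness in the twist
coordinates `(x, w = (2y + a₁x + a₃)/θ)` over the HILBERT CLASS FIELD `K[1] = K[ℓ]^{⟨σ_ℓ⟩}` (the genus trace `G_d` is only a
partial trace over lifts of `Gal(K[1]/K)`). Here `χ` is a genuine quadratic CHARACTER of `𝒢_ℓ = Gal(K[ℓ]/K)` (multiplicative,
`±1`-valued, odd on `σ_ℓ`) and everything descends to `K` itself:

* §1 (group algebra) `apply_finsum_chi_smul_eq_chi_smul`: `h·y_χ = χ(h)·y_χ` for `h ∈ 𝒢` (reindex `g ↦ hg`, `χ(h)² = 1`);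
  `chi_equivariant_of_four_zsmul_eq`: in a group without `2`-torsion, `4R = Y` and `hY = χ(h)Y` force `hR = χ(h)R`.
* §2 `two_dvd_derivedPoint_iff_four_dvd_chiSum_equivariant`: on the frame, **`P(ℓ) ∈ 2E(K[ℓ]) ⟺ y_χ = 4R` with `R`
  `χ`-EQUIVARIANT under all of `Gal(K[ℓ]/K)`** (`E(K[ℓ])[2] = 0`, p794939) — i.e. `R ∈ E(M_χ)^{χ}`, `M_χ = K[ℓ]^{ker χ}` a
  QUADRATIC extension of `K`.
* §3 the sign character of a square root: for `θ ∈ K[ℓ]`, `θ ≠ 0`, `θ² ∈ ℚ`, the function `χ_θ(g) = [gθ = θ] − [gθ = −θ]` is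
  multiplicative, `±1`-valued, and odd on `σ_ℓ` when `σ_ℓθ = −θ` (hand -3's `exists_sqrt_σ_eq_neg`: `θ² = ℓ*`);
  `coords_fixed_of_chiTheta_equivariant`: a `χ_θ`-equivariant affine point `(x, y)` has `x` and `w = (2y + a₁x + a₃)/θ` FIXED by
  `Gal(K[ℓ]/K)`; `coe_mem_range_of_forall_mem_ringClassGal`: fixed by `Gal(K[ℓ]/K)` ⟹ in `ι(K)` (Galois correspondence for `K[ℓ]/K`).
* §4 `two_dvd_derivedPoint_iff_exists_rational_twistCoords` (§5 `exists_rational_twistPoint_of_coords_mem_range` pulls the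
  twist equation back to `K`; §6 `exists_sqrt_chi_two_dvd_derivedPoint_iff` packages `θ`, `χ_θ` and the clause):
  **on H₂ at a CM-inert Zhang–Kolyvagin prime `ℓ`, with `θ² = ℓ*`,
  `σ_ℓθ = −θ`: `P(ℓ) ∈ 2E(K[ℓ])` iff `y_{χ_θ} = 4R` for a point `R ∈ E(K[ℓ])` which is `O` or affine `(x, y)` with
  `x ∈ ι(K)` and `w = (2y + a₁x + a₃)/θ ∈ ι(K)`** — and `ℓ*·w² = 4x³ + b₂x² + 2b₄x + b₆` (hand -3's `twist_equation`), so `(x, w)`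
  is a `K`-RATIONAL point of the quadratic twist `E^{(ℓ*)}` and `R` its transport `ι_θ(x, w)`.

So the crux's clause at a prime level reads: the genus Heegner point `y_{χ_θ} ∈ E(K(√ℓ*))^−`, i.e. a `K`-rational point of `E^{(ℓ*)}`
(`E^{(ℓ*)}(K) ⊇ E^{(ℓ*)}(ℚ) ⊕ E^{(d_Kℓ*)}(ℚ)`), is NOT `4`-divisible in `E^{(ℓ*)}(K)` — ONE quadratic twist of `E` over the FIXED field `K`
per Kolyvagin prime (input shape for Gross–Zagier in the genus pair and for 2-descent over `ℚ`). HONEST FRAMING: compositions of tree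
theorems with elementary group/coordinate algebra; the non-vanishing is untouched; no stub or item is closed; BSD is proved for no curve.

References: [cite: GrossLMS1991, §3 (3.5), §4 (4.1)] [cite: Cox2013, Thm. 9.18, §9.A, Thm. 11.1] [cite: SilvermanAEC2009, X.2, X.5].
-/

set_option linter.dupNamespace false -- `Summit.BirchSwinnertonDyer.BirchSwinnertonDyer.Theorems.…` (summit = sub)
set_option autoImplicit false

noncomputable section

open scoped Classical

namespace Summit.BirchSwinnertonDyer.BirchSwinnertonDyer.Theorems.CMKolyvaginConjecturePositiveDepth

open Finset WeierstrassCurve NumberField Literature.NumberTheory.EllipticCurves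
  Literature.NumberTheory.EllipticCurves.ModularForms
  Literature.NumberTheory.EllipticCurves.Rank1Residual

/-! ## §1 Group algebra: `y_χ` is `χ`-equivariant, and so is its quarter -/

section Algebra

variable {G : Type*} [Group G] {A : Type*} [AddCommGroup A] (ρ : G →* AddMonoid.End A)

/-- **`h·y_χ = χ(h)·y_χ`.** For a finite group `G` acting additively on `A` (`ρ`), a subgroup `𝒢`, a function `χ : G → ℤ`
that is multiplicative and `±1`-valued on `𝒢`, and `h ∈ 𝒢`: `ρ h (Σ_{g ∈ 𝒢} χ(g)·ρ g y) = χ(h)·Σ_{g ∈ 𝒢} χ(g)·ρ g y`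
(reindex `g ↦ hg`; `χ(h)² = 1`). [folklore] -/
theorem apply_finsum_chi_smul_eq_chi_smul [Finite G] (𝒢 : Subgroup G) (χ : G → ℤ)
    (hmul : ∀ g ∈ 𝒢, ∀ h ∈ 𝒢, χ (g * h) = χ g * χ h) (hχ1 : ∀ g ∈ 𝒢, χ g = 1 ∨ χ g = -1)
    {h : G} (hh : h ∈ 𝒢) (y : A) :
    ρ h (∑ᶠ g ∈ (𝒢 : Set G), χ g • ρ g y) = χ h • ∑ᶠ g ∈ (𝒢 : Set G), χ g • ρ g y := by
  have h𝒢 : (𝒢 : Set G).Finite := Set.toFinite _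
  rw [finsum_mem_eq_finite_toFinset_sum _ h𝒢, map_sum, Finset.smul_sum]
  have hχh : χ h * χ h = 1 := by
    rcases hχ1 h hh with h1 | h1 <;> rw [h1] <;> norm_num
  refine Finset.sum_nbij' (fun g ↦ h * g) (fun g ↦ h⁻¹ * g) (fun g hg ↦ ?_) (fun g hg ↦ ?_) (fun g _ ↦ ?_)
    (fun g _ ↦ ?_) (fun g hg ↦ ?_)
  · rw [Set.Finite.mem_toFinset, SetLike.mem_coe] at hg ⊢
    exact 𝒢.mul_mem hh hg
  · rw [Set.Finite.mem_toFinset, SetLike.mem_coe] at hg ⊢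
    exact 𝒢.mul_mem (𝒢.inv_mem hh) hg
  · exact inv_mul_cancel_left h g
  · exact mul_inv_cancel_left h g
  · rw [Set.Finite.mem_toFinset, SetLike.mem_coe] at hg
    rw [hmul h hh g hg, ← smul_smul, smul_smul (χ h) (χ h), hχh, one_smul, map_zsmul, map_mul,
      AddMonoid.End.coe_mul, Function.comp_apply]

/-- **Equivariance descends through `4`.** If `A` has no `2`-torsion, `ρ h Y = χ(h)·Y` and `4R = Y`, then `ρ h R = χ(h)·R`
(`4·(ρ h R − χ(h)R) = 0` and `A[4] = 0`). [folklore] -/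
theorem chi_equivariant_of_four_zsmul_eq (h2 : ∀ T : A, (2 : ℤ) • T = 0 → T = 0) (χ : G → ℤ) {h : G}
    {Y R : A} (hY : ρ h Y = χ h • Y) (hR : (4 : ℤ) • R = Y) : ρ h R = χ h • R := by
  have h4 : (4 : ℤ) • (ρ h R - χ h • R) = 0 := by
    rw [smul_sub, ← map_zsmul, hR, hY, smul_comm, hR, sub_self]
  have h22 : (2 : ℤ) • ((2 : ℤ) • (ρ h R - χ h • R)) = 0 := by
    rw [smul_smul]
    exact h4
  exact sub_eq_zero.mp (h2 _ (h2 _ h22))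

end Algebra

variable {K : Type} [Field K] [NumberField K]

/-! ## §2 On the frame: `P(ℓ) ∈ 2E(K[ℓ]) ⟺ y_χ = 4R` with `R` `χ`-equivariant -/

/-- **`P(ℓ) ∈ 2E(K[ℓ]) ⟺ y_χ = 4R` with `R` `χ`-equivariant under `Gal(K[ℓ]/K)`.** Frame of the stub (`W/ℚ` globally minimal
with CM, `CMInert W 2`, `ρ̄_{W,2}` onto, `K` imaginary quadratic with odd `d_K ≠ −3`, Heegner for `N_E`), `ℓ` a Zhang–Kolyvagin
prime at `2` inert in `F`, `d` any datum of conductor `ℓ`, and `χ : Aut_ℚ(K[ℓ]) → ℤ` with `χ(gσ_ℓ) = −χ(g)` for all `g`,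
`±1`-valued and multiplicative on `𝒢_ℓ = Gal(K[ℓ]/K)` (a quadratic character of `𝒢_ℓ` odd on `G_ℓ`). Then the `2`-divisibility
of `P(ℓ)` is the `4`-divisibility of `y_χ = Σ_{g ∈ 𝒢_ℓ} χ(g)·g y(ℓ)` BY A `χ`-EQUIVARIANT POINT: `y_χ = 4R`, `hR = χ(h)R` for all
`h ∈ 𝒢_ℓ` — i.e. `R` lies in `E` of the quadratic extension `K[ℓ]^{ker χ}` of `K` and is anti-invariant under its Galois group.
(p796272's `two_dvd_derivedPoint_iff_four_dvd_chiSum`, §1, and `E(K[ℓ])[2] = 0` from p794939.)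
[cite: GrossLMS1991, §3 (3.5), §4 (4.1)] [cite: Cox2013, §9.A] -/
theorem two_dvd_derivedPoint_iff_four_dvd_chiSum_equivariant (W : WeierstrassCurve ℚ) [W.IsElliptic]
    [W.IsGloballyMinimal] [NeZero (W.conductorNorm ℤ)] (hCM : W.HasCM) (hin : CMInert W 2)
    (hρ : W.HasSurjectiveModNGaloisRep (2 : ℤ)) (hK : IsImaginaryQuadratic K)
    (hodd : Odd (NumberField.discr K)) (h3 : NumberField.discr K ≠ -3)
    (hH : SatisfiesHeegnerHypothesis (W.conductorNorm ℤ) K)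
    {Dt : ModularParametrizationData W (W.conductorNorm ℤ)} {β : ℤ} {ι : K →+* ℂ} {ℓ : ℕ}
    (hℓK : Zhang2014.IsKolyvaginPrime (W.conductorNorm ℤ) W K 2 ℓ) (hℓF : CMInert W ℓ)
    (d : KolyvaginHeegnerData Dt β ι ℓ)
    (χ : (ringClassField K ι ℓ ≃ₐ[ℚ] ringClassField K ι ℓ) → ℤ) (hχ : ∀ g, χ (g * d.σ ℓ) = -χ g)
    (hχ1 : ∀ g ∈ ringClassGal ι ℓ, χ g = 1 ∨ χ g = -1)
    (hmul : ∀ g ∈ ringClassGal ι ℓ, ∀ h ∈ ringClassGal ι ℓ, χ (g * h) = χ g * χ h) :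
    (∃ Q : (W.baseChange (ringClassField K ι ℓ)).toAffine.Point, (2 : ℤ) • Q = d.derivedPoint) ↔
      ∃ R : (W.baseChange (ringClassField K ι ℓ)).toAffine.Point,
        (∀ h ∈ ringClassGal ι ℓ, pointGalHom W (ringClassField K ι ℓ) h R = χ h • R) ∧
        (4 : ℤ) • R =
          ∑ᶠ g ∈ (ringClassGal ι ℓ : Set (ringClassField K ι ℓ ≃ₐ[ℚ] ringClassField K ι ℓ)),
            χ g • pointGalHom W (ringClassField K ι ℓ) g d.y := by
  rw [two_dvd_derivedPoint_iff_four_dvd_chiSum W hCM hin hρ hK hodd h3 hH hℓK hℓF d χ hχ hχ1]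
  refine ⟨fun ⟨R, hR⟩ ↦ ⟨R, fun h hh ↦ ?_, hR⟩, fun ⟨R, _, hR⟩ ↦ ⟨R, hR⟩⟩
  -- `Aut_ℚ(K[ℓ])` is finite (`K[ℓ]/K` finite Galois, `K/ℚ` finite; cf. `KolyvaginDepthDoor.finite_algEquiv_ringClassField`)
  haveI := (finiteDimensional_and_isGalois_ringClassField hK ι hℓK.1.ne_zero).1
  haveI : FiniteDimensional ℚ (ringClassField K ι ℓ) := Module.Finite.trans K (ringClassField K ι ℓ)
  haveI : Finite (ringClassField K ι ℓ ≃ₐ[ℚ] ringClassField K ι ℓ) := Finite.of_fintype _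
  exact chi_equivariant_of_four_zsmul_eq (pointGalHom W (ringClassField K ι ℓ))
    (twoTorsion_eq_zero_of_cmInert_prime W hCM hin hρ hK ι hH hℓK.1 hℓF) χ
    (apply_finsum_chi_smul_eq_chi_smul (pointGalHom W (ringClassField K ι ℓ)) (ringClassGal ι ℓ) χ hmul hχ1 hh d.y) hR

/-! ## §3 The sign character `χ_θ` of a square root and the coordinates of a `χ_θ`-equivariant point -/

section ChiTheta

variable {L : Type} [Field L] [Algebra ℚ L]

/-- **The sign character of `θ`.** For `θ ∈ L` with `θ² = c ∈ ℚ`, every `g ∈ Aut_ℚ(L)` has `gθ = ±θ`, so a function `χ` with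
`χ(g) = 1` when `gθ = θ` and `χ(g) = −1` otherwise (the sign character `χ_θ`; as a term, `fun g ↦ if gθ = θ then 1 else −1`)
satisfies: `χ(g) = 1 ∧ gθ = θ` or `χ(g) = −1 ∧ gθ = −θ`. [cite: SilvermanAEC2009, X.2 Prop. 2.4 (proof)] -/
theorem chiTheta_dichotomy {θ : L} {c : ℚ} (hθ2 : θ ^ 2 = algebraMap ℚ L c)
    (χ : (L ≃ₐ[ℚ] L) → ℤ) (hχp : ∀ g, g θ = θ → χ g = 1) (hχn : ∀ g, g θ ≠ θ → χ g = -1) (g : L ≃ₐ[ℚ] L) :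
    (χ g = 1 ∧ g θ = θ) ∨ (χ g = -1 ∧ g θ = -θ) := by
  by_cases hfix : g θ = θ
  · exact Or.inl ⟨hχp g hfix, hfix⟩
  · rcases algEquiv_apply_eq_or_eq_neg_of_sq_eq hθ2 g with h | h
    · exact absurd h hfix
    · exact Or.inr ⟨hχn g hfix, h⟩

/-- `χ_θ` is `±1`-valued. [folklore] -/
theorem chiTheta_eq_one_or (θ : L) (χ : (L ≃ₐ[ℚ] L) → ℤ) (hχp : ∀ g, g θ = θ → χ g = 1)
    (hχn : ∀ g, g θ ≠ θ → χ g = -1) (g : L ≃ₐ[ℚ] L) : χ g = 1 ∨ χ g = -1 := by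
  by_cases hfix : g θ = θ
  · exact Or.inl (hχp g hfix)
  · exact Or.inr (hχn g hfix)

/-- **`χ_θ` is multiplicative** (`θ ≠ 0`, `θ² ∈ ℚ`): `χ_θ(gh) = χ_θ(g)χ_θ(h)`. [folklore] -/
theorem chiTheta_mul [CharZero L] {θ : L} (hθ : θ ≠ 0) {c : ℚ} (hθ2 : θ ^ 2 = algebraMap ℚ L c)
    (χ : (L ≃ₐ[ℚ] L) → ℤ) (hχp : ∀ g, g θ = θ → χ g = 1) (hχn : ∀ g, g θ ≠ θ → χ g = -1)
    (g h : L ≃ₐ[ℚ] L) : χ (g * h) = χ g * χ h := by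
  have hθθ : -θ ≠ θ := fun e ↦ hθ (by
    have : (2 : L) * θ = 0 := by linear_combination -e
    simpa using this)
  have hgh : (g * h) θ = g (h θ) := rfl
  rcases chiTheta_dichotomy hθ2 χ hχp hχn g with ⟨hg1, hg2⟩ | ⟨hg1, hg2⟩ <;>
    rcases chiTheta_dichotomy hθ2 χ hχp hχn h with ⟨hh1, hh2⟩ | ⟨hh1, hh2⟩
  · rw [hg1, hh1, hχp _ (by rw [hgh, hh2, hg2])]
    norm_num
  · rw [hg1, hh1, hχn _ (by rw [hgh, hh2, map_neg, hg2]; exact hθθ)]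
    norm_num
  · rw [hg1, hh1, hχn _ (by rw [hgh, hh2, hg2]; exact hθθ)]
    norm_num
  · rw [hg1, hh1, hχp _ (by rw [hgh, hh2, map_neg, hg2, neg_neg])]
    norm_num

/-- **`χ_θ` is odd on `σ` when `σθ = −θ`**: `χ_θ(gσ) = −χ_θ(g)`. [folklore] -/
theorem chiTheta_mul_eq_neg_of_apply_eq_neg [CharZero L] {θ : L} (hθ : θ ≠ 0) {c : ℚ}
    (hθ2 : θ ^ 2 = algebraMap ℚ L c) (χ : (L ≃ₐ[ℚ] L) → ℤ) (hχp : ∀ g, g θ = θ → χ g = 1)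
    (hχn : ∀ g, g θ ≠ θ → χ g = -1) {σ : L ≃ₐ[ℚ] L} (hσθ : σ θ = -θ) (g : L ≃ₐ[ℚ] L) :
    χ (g * σ) = -χ g := by
  have hθθ : -θ ≠ θ := fun e ↦ hθ (by
    have : (2 : L) * θ = 0 := by linear_combination -e
    simpa using this)
  have hσ : χ σ = -1 := hχn σ (by rw [hσθ]; exact hθθ)
  rw [chiTheta_mul hθ hθ2 χ hχp hχn, hσ, mul_neg_one]

end ChiTheta

/-- **Coordinates of a `χ_θ`-equivariant affine point of `E(K[n])` are `𝒢`-fixed.** For `θ ∈ K[n]`, `θ ≠ 0`, `θ² ∈ ℚ`,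
`χ = χ_θ`, a subgroup `𝒢` of `Aut_ℚ(K[n])` and an affine point `R = (x, y) ∈ E(K[n])` with `hR = χ(h)·R` for all `h ∈ 𝒢`:
`hx = x` and `hw = w` for all `h ∈ 𝒢`, where `w = (2y + a₁x + a₃)/θ` (`χ(h) = 1`: `h` fixes `x, y, θ`; `χ(h) = −1`: `hR = −R`,
`hθ = −θ`, hand -3's `anti_iff_fixed_coords`). [cite: SilvermanAEC2009, III.2.3, X.2 Prop. 2.4 (proof)] -/
theorem coords_fixed_of_chiTheta_equivariant (W : WeierstrassCurve ℚ) {ι : K →+* ℂ} {n : ℕ}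
    {θ : ringClassField K ι n} (hθ : θ ≠ 0) {c : ℚ} (hθ2 : θ ^ 2 = algebraMap ℚ (ringClassField K ι n) c)
    (χ : (ringClassField K ι n ≃ₐ[ℚ] ringClassField K ι n) → ℤ) (hχp : ∀ g, g θ = θ → χ g = 1)
    (hχn : ∀ g, g θ ≠ θ → χ g = -1)
    (𝒢 : Subgroup (ringClassField K ι n ≃ₐ[ℚ] ringClassField K ι n)) {x y : ringClassField K ι n}
    (hns : (W.baseChange (ringClassField K ι n)).toAffine.Nonsingular x y)
    (hR : ∀ h ∈ 𝒢, pointGalHom W (ringClassField K ι n) h (.some x y hns) = χ h • (.some x y hns)) :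
    ∀ h ∈ 𝒢, h x = x ∧
      h ((2 * y + (W.baseChange (ringClassField K ι n)).toAffine.a₁ * x +
          (W.baseChange (ringClassField K ι n)).toAffine.a₃) / θ) =
        (2 * y + (W.baseChange (ringClassField K ι n)).toAffine.a₁ * x +
          (W.baseChange (ringClassField K ι n)).toAffine.a₃) / θ := by
  intro h hh
  have ha₁ : h (W.baseChange (ringClassField K ι n)).toAffine.a₁ = (W.baseChange (ringClassField K ι n)).toAffine.a₁ := by
    show h (algebraMap ℚ (ringClassField K ι n) W.a₁) = algebraMap ℚ (ringClassField K ι n) W.a₁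
    exact h.commutes _
  have ha₃ : h (W.baseChange (ringClassField K ι n)).toAffine.a₃ = (W.baseChange (ringClassField K ι n)).toAffine.a₃ := by
    show h (algebraMap ℚ (ringClassField K ι n) W.a₃) = algebraMap ℚ (ringClassField K ι n) W.a₃
    exact h.commutes _
  rcases chiTheta_dichotomy hθ2 χ hχp hχn h with ⟨h1, hfix⟩ | ⟨h1, hneg⟩
  · have hRR := hR h hh -- `hR = R`: `h` fixes `x` and `y`
    rw [h1, one_smul, pointGalHom_apply, WeierstrassCurve.Affine.Point.map_some,
      WeierstrassCurve.Affine.Point.some.injEq] at hRR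
    obtain ⟨hx, hy⟩ := hRR
    change h x = x at hx
    change h y = y at hy
    refine ⟨hx, ?_⟩
    rw [map_div₀, map_add, map_add, map_mul, map_mul, map_ofNat, hx, hy, ha₁, ha₃, hfix]
  · have hRR := hR h hh -- `hR = −R`: hand -3's coordinate dictionary
    rw [h1, neg_one_zsmul] at hRR
    exact (anti_iff_fixed_coords W h hθ hneg x y).mp ((pointGalHom_some_eq_neg_iff W h hns).mp hRR)

/-- **Fixed by `Gal(K[n]/K)` ⟹ in `ι(K)`** (`K` imaginary quadratic, `n ≠ 0`): the Galois correspondence for the finite Galois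
extension `K[n]/K` (tree `finiteDimensional_and_isGalois_ringClassField`) at the bottom field (Mathlib
`IsGalois.fixedField_fixingSubgroup ⊥`, `IntermediateField.mem_bot`); the tree's `ringClassGal ι n` is the subgroup of
`Aut_ℚ(K[n])` fixing `ι(K)` pointwise. [cite: Cox2013, §9.A, Thm. 11.1] -/
theorem coe_mem_range_of_forall_mem_ringClassGal (hK : IsImaginaryQuadratic K) (ι : K →+* ℂ) {n : ℕ} (hn : n ≠ 0)
    (x : ringClassField K ι n) (h : ∀ g ∈ ringClassGal ι n, g x = x) : (x : ℂ) ∈ Set.range ι := by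
  haveI := (finiteDimensional_and_isGalois_ringClassField hK ι hn).1
  haveI := (finiteDimensional_and_isGalois_ringClassField hK ι hn).2
  have hx : x ∈ (⊥ : IntermediateField K (ringClassField K ι n)) := by
    rw [← IsGalois.fixedField_fixingSubgroup (⊥ : IntermediateField K (ringClassField K ι n)),
      IntermediateField.mem_fixedField_iff]
    intro τ _
    have hτ' : τ.restrictScalars ℚ ∈ ringClassGal ι n := by
      rw [ringClassGal, mem_fixingSubgroup_iff]
      rintro y ⟨k, hk⟩
      rw [AlgEquiv.smul_def, AlgEquiv.restrictScalars_apply]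
      have hy : y = algebraMap K (ringClassField K ι n) k := Subtype.ext (by rw [coe_algebraMap_ringClassField]; exact hk.symm)
      rw [hy, AlgEquiv.commutes]
    have := h _ hτ'
    rwa [AlgEquiv.restrictScalars_apply] at this
  rw [IntermediateField.mem_bot] at hx
  obtain ⟨k, hk⟩ := hx
  exact ⟨k, by rw [← hk, coe_algebraMap_ringClassField]⟩

/-! ## §4 The crux's clause at a prime level: `y_{χ_θ}` is `4` times the transport of a `K`-rational point of `E^{(ℓ*)}` -/

/-- **Kolyvagin's clause at a CM-inert prime, descended to `K`.** On H₂ (`W/ℚ` globally minimal with CM, `2` inert in `F`,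
`ρ̄_{E,2}` onto), `K` imaginary quadratic with odd `d_K ≠ −3` and Heegner for `N_E`, `ℓ` a CM-inert Zhang–Kolyvagin prime at `2`,
`d` any datum of conductor `ℓ`, `θ ∈ K[ℓ]` with `θ ≠ 0`, `θ² = c ∈ ℚ` and `σ_ℓθ = −θ` (exists with `c = ℓ*`, hand -3's
`exists_sqrt_σ_eq_neg`), and `χ = χ_θ` the sign character of `θ` (`χ(g) = 1` if `gθ = θ`, `−1` otherwise): **`P_d(ℓ) ∈ 2E(K[ℓ])` iff `y_χ = Σ_{g ∈ 𝒢_ℓ} χ(g)·g y(ℓ)`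
is `4R` for a point `R ∈ E(K[ℓ])` which is `O` or an affine point `(x, y)` with `x ∈ ι(K)` and
`w = (2y + a₁x + a₃)/θ ∈ ι(K)`** — `(x, w)` is then a `K`-rational point of the twist `E^{(c)} : c·w² = 4x³ + b₂x² + 2b₄x + b₆`
(`twist_equation`) and `R = ι_θ(x, w) = (x, (θw − a₁x − a₃)/2)`. (§2 with `χ_θ`; §3; the Galois correspondence for `K[ℓ]/K`.)
[cite: GrossLMS1991, §3 (3.5), §4 (4.1)] [cite: SilvermanAEC2009, X.5 Cor. 5.4] [cite: Cox2013, Thm. 9.18, §9.A] -/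
theorem two_dvd_derivedPoint_iff_exists_rational_twistCoords (W : WeierstrassCurve ℚ) [W.IsElliptic]
    [W.IsGloballyMinimal] [NeZero (W.conductorNorm ℤ)] (hCM : W.HasCM) (hin : CMInert W 2)
    (hρ : W.HasSurjectiveModNGaloisRep (2 : ℤ)) (hK : IsImaginaryQuadratic K)
    (hodd : Odd (NumberField.discr K)) (h3 : NumberField.discr K ≠ -3)
    (hH : SatisfiesHeegnerHypothesis (W.conductorNorm ℤ) K)
    {Dt : ModularParametrizationData W (W.conductorNorm ℤ)} {β : ℤ} {ι : K →+* ℂ} {ℓ : ℕ}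
    (hℓK : Zhang2014.IsKolyvaginPrime (W.conductorNorm ℤ) W K 2 ℓ) (hℓF : CMInert W ℓ)
    (d : KolyvaginHeegnerData Dt β ι ℓ) {θ : ringClassField K ι ℓ} (hθ : θ ≠ 0) {c : ℚ}
    (hθ2 : θ ^ 2 = algebraMap ℚ (ringClassField K ι ℓ) c) (hσθ : d.σ ℓ θ = -θ)
    (χ : (ringClassField K ι ℓ ≃ₐ[ℚ] ringClassField K ι ℓ) → ℤ) (hχp : ∀ g, g θ = θ → χ g = 1)
    (hχn : ∀ g, g θ ≠ θ → χ g = -1) :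
    (∃ Q : (W.baseChange (ringClassField K ι ℓ)).toAffine.Point, (2 : ℤ) • Q = d.derivedPoint) ↔
      ∃ R : (W.baseChange (ringClassField K ι ℓ)).toAffine.Point,
        (4 : ℤ) • R =
          ∑ᶠ g ∈ (ringClassGal ι ℓ : Set (ringClassField K ι ℓ ≃ₐ[ℚ] ringClassField K ι ℓ)),
            χ g • pointGalHom W (ringClassField K ι ℓ) g d.y ∧
        ∀ (x y : ringClassField K ι ℓ) (h : (W.baseChange (ringClassField K ι ℓ)).toAffine.Nonsingular x y),
          R = .some x y h →
            (x : ℂ) ∈ Set.range ι ∧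
              (((2 * y + (W.baseChange (ringClassField K ι ℓ)).toAffine.a₁ * x +
                  (W.baseChange (ringClassField K ι ℓ)).toAffine.a₃) / θ : ringClassField K ι ℓ) : ℂ) ∈ Set.range ι := by
  rw [two_dvd_derivedPoint_iff_four_dvd_chiSum_equivariant W hCM hin hρ hK hodd h3 hH hℓK hℓF d χ
    (chiTheta_mul_eq_neg_of_apply_eq_neg hθ hθ2 χ hχp hχn hσθ) (fun g _ ↦ chiTheta_eq_one_or θ χ hχp hχn g)
    (fun g _ h _ ↦ chiTheta_mul hθ hθ2 χ hχp hχn g h)]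
  constructor
  · rintro ⟨R, hReq, hR⟩
    refine ⟨R, hR, fun x y h hRe ↦ ?_⟩
    subst hRe
    have hfix := coords_fixed_of_chiTheta_equivariant W hθ hθ2 χ hχp hχn (ringClassGal ι ℓ) h hReq
    exact ⟨coe_mem_range_of_forall_mem_ringClassGal hK ι hℓK.1.ne_zero x fun g hg ↦ (hfix g hg).1,
      coe_mem_range_of_forall_mem_ringClassGal hK ι hℓK.1.ne_zero _ fun g hg ↦ (hfix g hg).2⟩
  · rintro ⟨R, hR, -⟩
    haveI := (finiteDimensional_and_isGalois_ringClassField hK ι hℓK.1.ne_zero).1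
    haveI : FiniteDimensional ℚ (ringClassField K ι ℓ) := Module.Finite.trans K (ringClassField K ι ℓ)
    haveI : Finite (ringClassField K ι ℓ ≃ₐ[ℚ] ringClassField K ι ℓ) := Finite.of_fintype _
    refine ⟨R, fun g hg ↦ ?_, hR⟩
    exact chi_equivariant_of_four_zsmul_eq (pointGalHom W (ringClassField K ι ℓ))
      (twoTorsion_eq_zero_of_cmInert_prime W hCM hin hρ hK ι hH hℓK.1 hℓF) χ
      (apply_finsum_chi_smul_eq_chi_smul (pointGalHom W (ringClassField K ι ℓ)) (ringClassGal ι ℓ) χ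
        (fun g _ h _ ↦ chiTheta_mul hθ hθ2 χ hχp hχn g h) (fun g _ ↦ chiTheta_eq_one_or θ χ hχp hχn g) hg d.y) hR

/-! ## §5 The descended coordinates solve the twist equation IN `K` -/

/-- **A `K`-rational point of the twist.** For `θ ∈ K[n]`, `θ ≠ 0`, `θ² = c ∈ ℚ`, and an affine point `(x, y) ∈ E(K[n])` whose
twist coordinates `x` and `w = (2y + a₁x + a₃)/θ` lie in `ι(K)`: there are `k₁, k₂ ∈ K` with `ι k₁ = x`, `ι k₂ = w` and
**`c·k₂² = 4k₁³ + b₂k₁² + 2b₄k₁ + b₆` in `K`** — `(k₁, k₂) ∈ E^{(c)}(K)` for the completed-square model of the quadratic twist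
(hand -3's `twist_equation` in `K[n] ⊆ ℂ`, pulled back along the injection `ι`). [cite: SilvermanAEC2009, III.1 (b₂,b₄,b₆), X.5 Cor. 5.4] -/
theorem exists_rational_twistPoint_of_coords_mem_range (W : WeierstrassCurve ℚ) {ι : K →+* ℂ} {n : ℕ}
    {θ : ringClassField K ι n} (hθ : θ ≠ 0) {c : ℚ} (hθ2 : θ ^ 2 = algebraMap ℚ (ringClassField K ι n) c)
    {x y : ringClassField K ι n} (hxy : (W.baseChange (ringClassField K ι n)).toAffine.Equation x y)
    (hx : (x : ℂ) ∈ Set.range ι)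
    (hw : (((2 * y + (W.baseChange (ringClassField K ι n)).toAffine.a₁ * x +
        (W.baseChange (ringClassField K ι n)).toAffine.a₃) / θ : ringClassField K ι n) : ℂ) ∈ Set.range ι) :
    ∃ k₁ k₂ : K, ι k₁ = x ∧
      ι k₂ = (((2 * y + (W.baseChange (ringClassField K ι n)).toAffine.a₁ * x +
        (W.baseChange (ringClassField K ι n)).toAffine.a₃) / θ : ringClassField K ι n) : ℂ) ∧
      (c : K) * k₂ ^ 2 = 4 * k₁ ^ 3 + (W.b₂ : K) * k₁ ^ 2 + 2 * (W.b₄ : K) * k₁ + (W.b₆ : K) := by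
  obtain ⟨k₁, hk₁⟩ := hx
  obtain ⟨k₂, hk₂⟩ := hw
  refine ⟨k₁, k₂, hk₁, hk₂, ?_⟩
  have hw' : (2 * y + (W.baseChange (ringClassField K ι n)).toAffine.a₁ * x +
      (W.baseChange (ringClassField K ι n)).toAffine.a₃) / θ = algebraMap K (ringClassField K ι n) k₂ :=
    Subtype.ext (by rw [coe_algebraMap_ringClassField]; exact hk₂.symm)
  have hx' : x = algebraMap K (ringClassField K ι n) k₁ :=
    Subtype.ext (by rw [coe_algebraMap_ringClassField]; exact hk₁.symm)
  have h := twist_equation W hθ hθ2 hxy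
  rw [hw', hx'] at h
  have hq : ∀ q : ℚ, algebraMap ℚ (ringClassField K ι n) q = algebraMap K (ringClassField K ι n) (q : K) :=
    fun q ↦ by rw [eq_ratCast, map_ratCast]
  have hb₂ : (W.baseChange (ringClassField K ι n)).b₂ = algebraMap K (ringClassField K ι n) (W.b₂ : K) := by
    rw [WeierstrassCurve.baseChange, WeierstrassCurve.map_b₂, hq]
  have hb₄ : (W.baseChange (ringClassField K ι n)).b₄ = algebraMap K (ringClassField K ι n) (W.b₄ : K) := by
    rw [WeierstrassCurve.baseChange, WeierstrassCurve.map_b₄, hq]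
  have hb₆ : (W.baseChange (ringClassField K ι n)).b₆ = algebraMap K (ringClassField K ι n) (W.b₆ : K) := by
    rw [WeierstrassCurve.baseChange, WeierstrassCurve.map_b₆, hq]
  rw [hb₂, hb₄, hb₆, hq] at h
  apply (algebraMap K (ringClassField K ι n)).injective
  simp only [map_mul, map_add, map_pow, map_ofNat]
  exact h

/-! ## §6 Packaged form: at every CM-inert Kolyvagin prime, `P(ℓ) ∈ 2E(K[ℓ])` iff `y_{χ_θ} ∈ 4·ι_θ(E^{(ℓ*)}(K))` -/

/-- **The descended clause, packaged.** On H₂ (`W/ℚ` globally minimal with CM, `2` inert in `F`, `ρ̄_{E,2}` onto), `K` imaginary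
quadratic with odd `d_K ≠ −3` and Heegner for `N_E`, `ℓ` a CM-inert Zhang–Kolyvagin prime at `2`, `d` any datum of conductor `ℓ`:
there are `θ ∈ K[ℓ]` with `θ² = ℓ* = (−1)^{(ℓ−1)/2}ℓ`, `θ ≠ 0`, `σ_ℓθ = −θ` (hand -3's `exists_sqrt_σ_eq_neg`) and its sign character
`χ = χ_θ : Aut_ℚ(K[ℓ]) → {±1}` (multiplicative, odd on `σ_ℓ`), for which **`P_d(ℓ) ∈ 2E(K[ℓ])` iff
`y_χ = Σ_{g ∈ Gal(K[ℓ]/K)} χ(g)·g y(ℓ)` is `4R` with `R = O` or `R = (ι k₁, (θ·ι k₂ − a₁·ι k₁ − a₃)/2)` for a `K`-RATIONAL point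
`(k₁, k₂)` of the quadratic twist `E^{(ℓ*)} : ℓ*·k₂² = 4k₁³ + b₂k₁² + 2b₄k₁ + b₆`** — the genus Heegner point of the pair
`(E^{(ℓ*)}, E^{(d_Kℓ*)})` is `4` times the transport of a point of `E^{(ℓ*)}(K)`.
[cite: GrossLMS1991, §3 (3.5), §4 (4.1)] [cite: Cox2013, Thm. 9.18, §9.A] [cite: SilvermanAEC2009, X.5 Cor. 5.4] -/
theorem exists_sqrt_chi_two_dvd_derivedPoint_iff (W : WeierstrassCurve ℚ) [W.IsElliptic]
    [W.IsGloballyMinimal] [NeZero (W.conductorNorm ℤ)] (hCM : W.HasCM) (hin : CMInert W 2)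
    (hρ : W.HasSurjectiveModNGaloisRep (2 : ℤ)) (hK : IsImaginaryQuadratic K)
    (hodd : Odd (NumberField.discr K)) (h3 : NumberField.discr K ≠ -3)
    (hH : SatisfiesHeegnerHypothesis (W.conductorNorm ℤ) K)
    {Dt : ModularParametrizationData W (W.conductorNorm ℤ)} {β : ℤ} {ι : K →+* ℂ} {ℓ : ℕ}
    (hℓK : Zhang2014.IsKolyvaginPrime (W.conductorNorm ℤ) W K 2 ℓ) (hℓF : CMInert W ℓ)
    (d : KolyvaginHeegnerData Dt β ι ℓ) :
    ∃ (θ : ringClassField K ι ℓ) (χ : (ringClassField K ι ℓ ≃ₐ[ℚ] ringClassField K ι ℓ) → ℤ),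
      θ ^ 2 = algebraMap ℚ (ringClassField K ι ℓ) ((-1 : ℚ) ^ (ℓ / 2) * ℓ) ∧ θ ≠ 0 ∧ d.σ ℓ θ = -θ ∧
      (∀ g, g θ = θ → χ g = 1) ∧ (∀ g, g θ ≠ θ → χ g = -1) ∧
      (∀ g h, χ (g * h) = χ g * χ h) ∧ (∀ g, χ (g * d.σ ℓ) = -χ g) ∧
      ((∃ Q : (W.baseChange (ringClassField K ι ℓ)).toAffine.Point, (2 : ℤ) • Q = d.derivedPoint) ↔
        ∃ R : (W.baseChange (ringClassField K ι ℓ)).toAffine.Point,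
          (4 : ℤ) • R =
            ∑ᶠ g ∈ (ringClassGal ι ℓ : Set (ringClassField K ι ℓ ≃ₐ[ℚ] ringClassField K ι ℓ)),
              χ g • pointGalHom W (ringClassField K ι ℓ) g d.y ∧
          ∀ (x y : ringClassField K ι ℓ) (h : (W.baseChange (ringClassField K ι ℓ)).toAffine.Nonsingular x y),
            R = .some x y h →
              ∃ k₁ k₂ : K, ι k₁ = x ∧
                ι k₂ = (((2 * y + (W.baseChange (ringClassField K ι ℓ)).toAffine.a₁ * x +
                  (W.baseChange (ringClassField K ι ℓ)).toAffine.a₃) / θ : ringClassField K ι ℓ) : ℂ) ∧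
                (((-1 : ℚ) ^ (ℓ / 2) * ℓ : ℚ) : K) * k₂ ^ 2 =
                  4 * k₁ ^ 3 + (W.b₂ : K) * k₁ ^ 2 + 2 * (W.b₄ : K) * k₁ + (W.b₆ : K)) := by
  obtain ⟨θ, hθ2, hθ, hσθ⟩ := exists_sqrt_σ_eq_neg hK hℓK.1 hℓK.2.2.2.1 hℓK.2.2.1 d
  have hχp : ∀ g : ringClassField K ι ℓ ≃ₐ[ℚ] ringClassField K ι ℓ,
      g θ = θ → (if g θ = θ then (1 : ℤ) else -1) = 1 := fun g hg ↦ if_pos hg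
  have hχn : ∀ g : ringClassField K ι ℓ ≃ₐ[ℚ] ringClassField K ι ℓ,
      g θ ≠ θ → (if g θ = θ then (1 : ℤ) else -1) = -1 := fun g hg ↦ if_neg hg
  refine ⟨θ, fun g ↦ if g θ = θ then 1 else -1, hθ2, hθ, hσθ, hχp, hχn,
    fun g h ↦ chiTheta_mul hθ hθ2 _ hχp hχn g h, chiTheta_mul_eq_neg_of_apply_eq_neg hθ hθ2 _ hχp hχn hσθ, ?_⟩
  rw [two_dvd_derivedPoint_iff_exists_rational_twistCoords W hCM hin hρ hK hodd h3 hH hℓK hℓF d hθ hθ2 hσθ _ hχp hχn]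
  refine exists_congr fun R ↦ and_congr_right fun _ ↦ forall₃_congr fun x y h ↦ imp_congr_right fun _ ↦ ?_
  constructor
  · rintro ⟨hx, hw⟩
    exact exists_rational_twistPoint_of_coords_mem_range W hθ hθ2 h.left hx hw
  · rintro ⟨k₁, k₂, hk₁, hk₂, -⟩
    exact ⟨⟨k₁, hk₁⟩, ⟨k₂, hk₂⟩⟩

end Summit.BirchSwinnertonDyer.BirchSwinnertonDyer.Theorems.CMKolyvaginConjecturePositiveDepth

end
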